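import Mathlib.Combinatorics.SetFamily.FourFunctions
import Mathlib.Data.Finset.SymmDiff
import Mathlib.Tactic
import HarnessLib
import HarnessLib.Audit.Tags
import Summits.CriticalPhenomena.PercolationContinuityZ3.Theorems.PercNearOneGluingNoHeavyLowerTailSahiMSWitness
import Summits.CriticalPhenomena.PercolationContinuityZ3.Theorems.PercNearOneGluingNoHeavyLowerTailSahiMSSlices

/-!
# Equality in the Marica–Schönheim inequality, IV: rigid points are twins

Support file (seat `prim-masterthm-p1`, gen 29; `--supports stmt-CriticalPhenomena-4575`).  No `sorry`, no new definitions, standard axioms.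
Memo `run/shared/lean/prim/prim-masterthm/FROM-prim-masterthm-p1-g29-MS-EQUALITY.md`, Lemma 4.

`IsWitness.coordinate_split`: let `P = L ⊔ H` have a witness `M` and suppose no difference `h \ l` (`h ∈ H`, `l ∈ L`) is of the form `l' \ p`
(`l' ∈ L`, `p ∈ P`) or `h' \ h''` (`h', h'' ∈ H`).  Then some point `x` lies in every member of `H` and in no member of `L`.  Two dual cases
(`M ∈ L`: `H` is an up-set in the outer part `p \ M`, generated by an atom; `M ∈ H`: `L` is a down-set in the `M`-part `p ∩ M`, below a co-atom),
both written out (no complementation).  `slices_coordinate`: the hypothesis is exactly what `#(Q \\ Q) = #Q` gives for the slices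
`L = slice₀ Q r`, `H = slice₁ Q r` when their common part is empty (`…SahiMSSlices.slices_of_card_diffs_eq`); conclusion: `x` is a twin of `r`. [this work]
-/

namespace Summit.CriticalPhenomena.PercolationContinuityZ3.Theorems.SahiMSEquality

open Finset
open scoped FinsetFamily symmDiff

variable {α : Type*} [DecidableEq α]

/-! ### 7. Rigid points: a split with no common part is a coordinate split (memo Lemma 4) -/

namespace IsWitness

variable {L H : Finset (Finset α)} {M : Finset α}

/-- Lemma 4, case `M ∈ L`. [this work] -/
theorem coordinate_split_of_mem_left (hW : IsWitness (L ∪ H) M) (hdisj : Disjoint L H) (hH : H.Nonempty)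
    (hstar : ∀ X ∈ H \\ L, X ∉ L \\ (L ∪ H) ∧ X ∉ H \\ H) (hML : M ∈ L) :
    ∃ x, (∀ h ∈ H, x ∈ h) ∧ (∀ l ∈ L, x ∉ l) := by
  have memP_L : ∀ {p}, p ∈ L → p ∈ L ∪ H := fun hp => mem_union.2 (Or.inl hp)
  have memP_H : ∀ {p}, p ∈ H → p ∈ L ∪ H := fun hp => mem_union.2 (Or.inr hp)
  have notL_of_H : ∀ {p}, p ∈ H → p ∉ L := fun hp hp' => disjoint_left.1 hdisj hp' hp
  have H_of_notL : ∀ {p}, p ∈ L ∪ H → p ∉ L → p ∈ H := fun hp hp' => (mem_union.1 hp).resolve_left hp'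
  -- (1) H-membership is decided by the outer part, upwards
  have claim1 : ∀ h ∈ H, ∀ p ∈ L ∪ H, h \ M ⊆ p \ M → p ∈ H := by
    intro h hh p hp hsub
    refine H_of_notL hp fun hpL => ?_
    have hX : h \ M ∈ H \\ L := sdiff_mem_diffs hh hML
    obtain ⟨c, hc, hcD⟩ := hW.exists_sdiff_eq_sdiff hp (memP_H hh)
    have hp'' : (p ∩ M) ∪ (c \ M) ∈ L ∪ H := hW.exchange hc hp
    have e : p \ ((p ∩ M) ∪ (c \ M)) = h \ M := by
      ext x
      have hcx : x ∈ c \ M ↔ x ∈ (p \ M) \ (h \ M) := by rw [hcD]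
      have hsx : x ∈ h \ M → x ∈ p \ M := fun hx => hsub hx
      simp only [mem_sdiff, mem_union, mem_inter] at hcx hsx ⊢
      tauto
    exact (hstar _ hX).1 (e ▸ sdiff_mem_diffs hpL hp'')
  have c1a : ∀ h ∈ H, h ∪ M ∈ H := fun h hh =>
    claim1 h hh _ (hW.union_mem (memP_H hh)) (by intro x hx; simp only [mem_sdiff, mem_union] at hx ⊢; tauto)
  have c1b : ∀ l ∈ L, l ∪ M ∈ L := by
    intro l hl
    by_contra hn
    have hlMH : l ∪ M ∈ H := H_of_notL (hW.union_mem (memP_L hl)) hn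
    have := claim1 _ hlMH l (memP_L hl) (by intro x hx; simp only [mem_sdiff, mem_union] at hx ⊢; tauto)
    exact notL_of_H this hl
  -- (2) g := M ∪ (D_h \ D_l) ∈ H
  have claim2 : ∀ h ∈ H, ∀ l ∈ L, M ∪ ((h \ M) \ (l \ M)) ∈ H := by
    intro h hh l hl
    obtain ⟨c, hc, hcD⟩ := hW.exists_sdiff_eq_sdiff (memP_H hh) (memP_L hl)
    have hg : c ∪ M ∈ L ∪ H := hW.union_mem hc
    have eg : c ∪ M = M ∪ ((h \ M) \ (l \ M)) := by
      rw [← hcD]; ext x; simp only [mem_union, mem_sdiff]; tauto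
    rw [← eg]
    refine H_of_notL hg fun hgL => ?_
    have hY : (h ∪ M) \ (l ∪ M) ∈ H \\ L := sdiff_mem_diffs (c1a h hh) (c1b l hl)
    have e1 : (h ∪ M) \ (l ∪ M) = (h \ M) \ (l \ M) := by
      ext x; simp only [mem_sdiff, mem_union]; tauto
    have e2 : (c ∪ M) \ M = (h \ M) \ (l \ M) := by
      rw [← hcD]; ext x; simp only [mem_sdiff, mem_union]; tauto
    rw [e1] at hY
    exact (hstar _ hY).1 (e2 ▸ sdiff_mem_diffs hgL (memP_L hML))
  -- (3) (D_h \ D_l) meets every D_{h₂}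
  have claim3 : ∀ h ∈ H, ∀ h₂ ∈ H, ∀ l ∈ L, (((h \ M) \ (l \ M)) ∩ (h₂ \ M)).Nonempty := by
    intro h hh h₂ hh₂ l hl
    rw [nonempty_iff_ne_empty]
    intro hE
    have hg := claim2 h hh l hl
    have hh₂M := c1a h₂ hh₂
    have hY : (h ∪ M) \ (l ∪ M) ∈ H \\ L := sdiff_mem_diffs (c1a h hh) (c1b l hl)
    have e1 : (h ∪ M) \ (l ∪ M) = (h \ M) \ (l \ M) := by
      ext x; simp only [mem_sdiff, mem_union]; tauto
    have e2 : (M ∪ ((h \ M) \ (l \ M))) \ (h₂ ∪ M) = (h \ M) \ (l \ M) := by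
      ext x
      have hx : x ∈ ((h \ M) \ (l \ M)) ∩ (h₂ \ M) ↔ x ∈ (∅ : Finset α) := by rw [hE]
      simp only [mem_inter, mem_sdiff, mem_union, notMem_empty, iff_false] at hx ⊢
      tauto
    rw [e1] at hY
    exact (hstar _ hY).2 (e2 ▸ sdiff_mem_diffs hg hh₂M)
  -- (4) a member of H with smallest outer part; its outer part is an atom
  obtain ⟨hm, hhm, hmin⟩ := exists_min_image H (fun h => #(h \ M)) hH
  have hDm_ne : (hm \ M).Nonempty := by
    rw [nonempty_iff_ne_empty]
    intro h0
    have := claim1 hm hhm M (memP_L hML) (by rw [h0]; exact empty_subset _)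
    exact notL_of_H this hML
  have claim4 : ∀ p ∈ L ∪ H, (p \ M) ∩ (hm \ M) = ∅ ∨ hm \ M ⊆ p \ M := by
    intro p hp
    by_cases hE : (p \ M) ∩ (hm \ M) = ∅
    · exact Or.inl hE
    right
    by_contra hns
    obtain ⟨q, hq, hqD⟩ := hW.exists_sdiff_eq_inter hp (memP_H hhm)
    have hq' : q ∪ M ∈ L ∪ H := hW.union_mem hq
    have eq' : (q ∪ M) \ M = (p \ M) ∩ (hm \ M) := by
      rw [← hqD]; ext x; simp only [mem_sdiff, mem_union]; tauto
    have hlt : #((p \ M) ∩ (hm \ M)) < #(hm \ M) := by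
      apply card_lt_card
      refine ⟨inter_subset_right, fun hsub => hns ?_⟩
      exact fun x hx => (mem_inter.1 (hsub hx)).1
    -- q ∪ M ∈ L (else minimality fails)
    have hq'L : q ∪ M ∈ L := by
      by_contra hn
      have := hmin _ (H_of_notL hq' hn)
      rw [eq'] at this
      omega
    -- claim2 with l = q ∪ M gives a member of H with outer part D_m \ E, smaller than D_m
    have hg := claim2 hm hhm _ hq'L
    have := hmin _ hg
    have e3 : (M ∪ ((hm \ M) \ ((q ∪ M) \ M))) \ M = (hm \ M) \ ((p \ M) ∩ (hm \ M)) := by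
      rw [eq']; ext x; simp only [mem_sdiff, mem_union, mem_inter]; tauto
    rw [e3] at this
    have hlt2 : #((hm \ M) \ ((p \ M) ∩ (hm \ M))) < #(hm \ M) := by
      apply card_lt_card
      refine ⟨sdiff_subset, fun hsub => hE ?_⟩
      rw [← subset_empty]
      intro x hx
      exact absurd hx (mem_sdiff.1 (hsub (mem_inter.1 hx).2)).2
    omega
  -- (5) the atom lies in every member of H and in no member of L
  obtain ⟨x, hx⟩ := hDm_ne
  refine ⟨x, fun h hh => ?_, fun l hl hxl => ?_⟩
  · have hne := claim3 hm hhm h hh M hML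
    rcases claim4 h (memP_H hh) with h0 | hsub
    · exfalso
      rw [nonempty_iff_ne_empty] at hne
      apply hne
      rw [← subset_empty, ← h0]
      intro y hy
      obtain ⟨hy1, hy2⟩ := mem_inter.1 hy
      exact mem_inter.2 ⟨hy2, (mem_sdiff.1 hy1).1⟩
    · exact (mem_sdiff.1 (hsub hx)).1
  · have hxM : x ∉ M := (mem_sdiff.1 hx).2
    rcases claim4 l (memP_L hl) with h0 | hsub
    · have : x ∈ (l \ M) ∩ (hm \ M) := mem_inter.2 ⟨mem_sdiff.2 ⟨hxl, hxM⟩, hx⟩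
      rw [h0] at this; exact notMem_empty x this
    · exact notL_of_H (claim1 hm hhm l (memP_L hl) hsub) hl

/-- Lemma 4, case `M ∈ H`. [this work] -/
theorem coordinate_split_of_mem_right (hW : IsWitness (L ∪ H) M) (hdisj : Disjoint L H) (hL : L.Nonempty) (hH : H.Nonempty)
    (hstar : ∀ X ∈ H \\ L, X ∉ L \\ (L ∪ H) ∧ X ∉ H \\ H) (hMH : M ∈ H) :
    ∃ x, (∀ h ∈ H, x ∈ h) ∧ (∀ l ∈ L, x ∉ l) := by
  have memP_L : ∀ {p}, p ∈ L → p ∈ L ∪ H := fun hp => mem_union.2 (Or.inl hp)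
  have memP_H : ∀ {p}, p ∈ H → p ∈ L ∪ H := fun hp => mem_union.2 (Or.inr hp)
  have notL_of_H : ∀ {p}, p ∈ H → p ∉ L := fun hp hp' => disjoint_left.1 hdisj hp' hp
  have H_of_notL : ∀ {p}, p ∈ L ∪ H → p ∉ L → p ∈ H := fun hp hp' => (mem_union.1 hp).resolve_left hp'
  have L_of_notH : ∀ {p}, p ∈ L ∪ H → p ∉ H → p ∈ L := fun hp hp' => (mem_union.1 hp).resolve_right hp'
  -- l ∪ M ∈ H for l ∈ L
  have c0 : ∀ l ∈ L, l ∪ M ∈ H := by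
    intro l hl
    refine H_of_notL (hW.union_mem (memP_L hl)) fun hlM => ?_
    have hX : M \ l ∈ H \\ L := sdiff_mem_diffs hMH hl
    have e : (l ∪ M) \ l = M \ l := by ext x; simp only [mem_sdiff, mem_union]; tauto
    exact (hstar _ hX).1 (e ▸ sdiff_mem_diffs hlM (memP_L hl))
  -- (1') L-membership is decided by the M-part, downwards
  have claim1 : ∀ l ∈ L, ∀ p ∈ L ∪ H, p ∩ M ⊆ l ∩ M → p ∈ L := by
    intro l hl p hp hsub
    refine L_of_notH hp fun hpH => ?_
    have hX : p \ l ∈ H \\ L := sdiff_mem_diffs hpH hl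
    have e : p \ (l ∪ M) = p \ l := by
      ext x
      have hsx : x ∈ p ∩ M → x ∈ l ∩ M := fun hx => hsub hx
      simp only [mem_sdiff, mem_union, mem_inter] at hsx ⊢
      tauto
    exact (hstar _ hX).2 (e ▸ sdiff_mem_diffs hpH (c0 l hl))
  have c1a : ∀ l ∈ L, l ∩ M ∈ L := fun l hl =>
    claim1 l hl _ (hW.inter_mem (memP_L hl)) (by intro x hx; simp only [mem_inter] at hx ⊢; tauto)
  have c1b : ∀ h ∈ H, h ∩ M ∈ H := by
    intro h hh
    refine H_of_notL (hW.inter_mem (memP_H hh)) fun hn => ?_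
    exact notL_of_H hh (claim1 _ hn h (memP_H hh) (by intro x hx; simp only [mem_inter] at hx ⊢; tauto))
  -- (2') the member g with M-part (M \ h) ∪ (l ∩ M) and empty outer part lies in L
  have claim2 : ∀ h ∈ H, ∀ l ∈ L, ∀ z ∈ L ∪ H, z ∩ M = (M \ h) ∪ (l ∩ M) → z ∩ M ∈ L := by
    intro h hh l hl z hz hzU
    refine L_of_notH (hW.inter_mem hz) fun hgH => ?_
    have hX : (h ∩ M) \ (l ∩ M) ∈ H \\ L := sdiff_mem_diffs (c1b h hh) (c1a l hl)
    have e : M \ (z ∩ M) = (h ∩ M) \ (l ∩ M) := by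
      ext x
      have hzx : x ∈ z ∩ M ↔ x ∈ (M \ h) ∪ (l ∩ M) := by rw [hzU]
      simp only [mem_inter, mem_union, mem_sdiff] at hzx ⊢
      tauto
    exact (hstar _ hX).2 (e ▸ sdiff_mem_diffs hMH hgH)
  -- (3') U_h \ U_l is never inside U_{l₂}
  have claim3 : ∀ h ∈ H, ∀ l ∈ L, ∀ l₂ ∈ L, ¬ (h ∩ M) \ (l ∩ M) ⊆ l₂ ∩ M := by
    intro h hh l hl l₂ hl₂ hsub
    obtain ⟨z, hz, hzU⟩ := hW.exists_inter_eq_compl_sdiff (memP_H hh) (memP_L hl)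
    have hg := claim2 h hh l hl z hz hzU
    have hX : (h ∩ M) \ (l ∩ M) ∈ H \\ L := sdiff_mem_diffs (c1b h hh) (c1a l hl)
    have e : (l₂ ∩ M) \ (z ∩ M) = (h ∩ M) \ (l ∩ M) := by
      ext x
      have hzx : x ∈ z ∩ M ↔ x ∈ (M \ h) ∪ (l ∩ M) := by rw [hzU]
      have hsx : x ∈ (h ∩ M) \ (l ∩ M) → x ∈ l₂ ∩ M := fun hx => hsub hx
      simp only [mem_inter, mem_union, mem_sdiff] at hzx hsx ⊢
      tauto
    exact (hstar _ hX).1 (e ▸ sdiff_mem_diffs (c1a l₂ hl₂) (hW.inter_mem hz))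
  -- (4') a member of L with largest M-part; its co-part is a co-atom
  obtain ⟨lm, hlm, hmax⟩ := exists_max_image L (fun l => #(l ∩ M)) hL
  have hUm_ne : lm ∩ M ≠ M := by
    intro hE
    obtain ⟨h, hh⟩ := hH
    exact notL_of_H hh (claim1 lm hlm h (memP_H hh) (by rw [hE]; exact inter_subset_right))
  have claim4 : ∀ p ∈ L ∪ H, p ∩ M ⊆ lm ∩ M ∨ M ⊆ (p ∩ M) ∪ (lm ∩ M) := by
    intro p hp
    by_cases hsub : p ∩ M ⊆ lm ∩ M
    · exact Or.inl hsub
    right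
    obtain ⟨z, hz, hzU⟩ := hW.exists_inter_eq_union hp (memP_L hlm)
    have hq : z ∩ M ∈ L ∪ H := hW.inter_mem hz
    have hlt : #(lm ∩ M) < #(z ∩ M) := by
      apply card_lt_card
      rw [hzU]
      refine ⟨subset_union_right, fun h' => hsub fun x hx => h' (mem_union.2 (Or.inl hx))⟩
    have hqH : z ∩ M ∈ H := by
      refine H_of_notL hq fun hqL => ?_
      have := hmax _ hqL
      rw [inter_assoc, inter_self] at this
      omega
    obtain ⟨z', hz', hz'U⟩ := hW.exists_inter_eq_compl_sdiff (memP_H hqH) (memP_L hlm)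
    have hg := claim2 _ hqH lm hlm z' hz' hz'U
    have hle := hmax _ hg
    rw [inter_assoc, inter_self] at hle
    have hge : lm ∩ M ⊆ z' ∩ M := by rw [hz'U]; exact subset_union_right
    have heq : lm ∩ M = z' ∩ M := eq_of_subset_of_card_le hge hle
    intro x hxM
    by_contra hxn
    have hx1 : x ∉ z ∩ M := by rw [hzU]; exact hxn
    have hx2 : x ∈ z' ∩ M := by
      rw [hz'U]; exact mem_union.2 (Or.inl (mem_sdiff.2 ⟨hxM, fun hxz => hx1 hxz⟩))
    rw [← heq] at hx2
    exact hxn (mem_union.2 (Or.inr hx2))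
  -- (5') β := M \ U_m lies in every member of H and meets no member of L
  have hβ : (M \ (lm ∩ M)).Nonempty := by
    rw [nonempty_iff_ne_empty]
    intro h0
    apply hUm_ne
    apply Subset.antisymm inter_subset_right
    intro x hx
    by_contra hxn
    have : x ∈ M \ (lm ∩ M) := mem_sdiff.2 ⟨hx, hxn⟩
    rw [h0] at this; exact notMem_empty x this
  obtain ⟨x, hx⟩ := hβ
  obtain ⟨hxM, hxUm⟩ := mem_sdiff.1 hx
  refine ⟨x, fun h hh => ?_, fun l hl hxl => ?_⟩
  · rcases claim4 h (memP_H hh) with hsub | hsub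
    · exact absurd (claim1 lm hlm h (memP_H hh) hsub) (notL_of_H hh)
    · rcases mem_union.1 (hsub hxM) with h1 | h1
      · exact (mem_inter.1 h1).1
      · exact absurd h1 hxUm
  · rcases claim4 l (memP_L hl) with hsub | hsub
    · exact hxUm (hsub (mem_inter.2 ⟨hxl, hxM⟩))
    · have hc := claim3 M hMH lm hlm l hl
      apply hc
      intro y hy
      obtain ⟨hy1, hy2⟩ := mem_sdiff.1 hy
      have hyM : y ∈ M := (mem_inter.1 hy1).2
      rcases mem_union.1 (hsub hyM) with h1 | h1
      · exact h1
      · exact absurd h1 hy2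

/-- **Rigid split = coordinate split (memo Lemma 4).**  If `P = L ⊔ H` has a witness and no difference `h \ l` is a difference `l' \ p`
or `h' \ h''`, then some point `x` lies in every member of `H` and in no member of `L`. [this work] -/
theorem coordinate_split (hW : IsWitness (L ∪ H) M) (hdisj : Disjoint L H) (hL : L.Nonempty) (hH : H.Nonempty)
    (hstar : ∀ X ∈ H \\ L, X ∉ L \\ (L ∪ H) ∧ X ∉ H \\ H) :
    ∃ x, (∀ h ∈ H, x ∈ h) ∧ (∀ l ∈ L, x ∉ l) := by
  rcases mem_union.1 (hW.mem (hL.mono subset_union_left)) with hM | hM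
  · exact hW.coordinate_split_of_mem_left hdisj hH hstar hM
  · exact hW.coordinate_split_of_mem_right hdisj hL hH hstar hM

end IsWitness

/-- **Rigid points of an equality family are twins.**  If `#(Q \\ Q) = #Q`, the slices at `r` are both non-empty with EMPTY common
part, and `P = slice₀ ∪ slice₁` has a witness, then some `x` lies in every member of `slice₁` and in no member of `slice₀`
(so `x` and `r` are twins in `Q`). [this work] -/
theorem slices_coordinate {Q : Finset (Finset α)} {r : α} (hQ : #(Q \\ Q) = #Q)
    (hT : slice₀ Q r ∩ slice₁ Q r = ∅) (h₀ : (slice₀ Q r).Nonempty) (h₁ : (slice₁ Q r).Nonempty) {M : Finset α}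
    (hW : IsWitness (slice₀ Q r ∪ slice₁ Q r) M) :
    ∃ x, (∀ h ∈ slice₁ Q r, x ∈ h) ∧ (∀ l ∈ slice₀ Q r, x ∉ l) := by
  obtain ⟨_, _, hAB⟩ := slices_of_card_diffs_eq Q r hQ
  have hA := slice₀_diffs Q r
  have hB := slice₁_diffs Q r
  refine hW.coordinate_split (disjoint_iff_inter_eq_empty.2 hT) h₀ h₁ ?_
  intro X hX
  have hXB : X ∈ slice₁ (Q \\ Q) r := by rw [hB]; exact hX
  have hXA : X ∉ slice₀ (Q \\ Q) r := by
    intro hXA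
    have : X ∈ slice₀ (Q \\ Q) r ∩ slice₁ (Q \\ Q) r := mem_inter.2 ⟨hXA, hXB⟩
    rw [hAB, hT] at this
    simp at this
  rw [hA] at hXA
  exact ⟨fun h => hXA (mem_union.2 (Or.inl h)), fun h => hXA (mem_union.2 (Or.inr h))⟩

end Summit.CriticalPhenomena.PercolationContinuityZ3.Theorems.SahiMSEquality
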